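import Mathlib.Analysis.Calculus.BumpFunction.FiniteDimension
import Mathlib.Analysis.InnerProductSpace.EuclideanDist
import Literature.Analysis.Calculus.ParametricSliceJets                           -- ★ p851003 (this seat): `fderiv_slice_fst_apply` (the `Q × ℝ` case), `contDiff_uncurry_fderiv_apply`; brings ★ `DirDerivOpenCommute` (`contDiffOn_dirDeriv`)
import HarnessLib

/-!
# Families smooth on an OPEN parameter set: localisation to a global family near each parameter, the `Q × M` slice derivative, and closure of the open-set class
# under a parameter derivative (Hörmander §1.1–1.4: cut-off functions; Thm. 1.1.8)

Topic `Analysis/Calculus`; namespace `Literature.Analysis.Calculus`.  THEOREMS ONLY (no `def`, no instance, no notation, no axiom, no named fact, no `sorry`); Mathlib + ★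
`ParametricSliceJets` ∕ `DirDerivOpenCommute`.  Cell `pub/hodgecm-mathlib`, crux H413 (`stmt-HodgeConjecture-24833`), line LH3 (closer stub `stub_N9`), LETTER L1 clause (I₁) at the
X′-CORNERS (organ O-L1e of leaf v5), brick **(X3-rk1) (ii)** «the OPEN-PARAMETER-SET twin of (B-par)» (F0P3a-p02 (g21)'s split 2026-09-02T11:00:14Z under LH3-plan (g4) RULING #18;
author F0P3a-p04 (g24)) — GENERIC HALF.  WHY: in the nested corner readers the next family `(q, ψ₂) ↦ (X₁ ↦ Φ₂(Θ_q(X₁, ·))(ψ₂))` is smooth only for `ψ₂` in the OPEN punctured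
interval, so the reader sockets `h1 ∕ h2 ∕ hcl` are needed for the class «`ContDiffOn ℝ ∞ (uncurry Θ) (O ×ˢ univ)`, one compact support on `O`», `O` open; every pointwise-local
statement about such a family reduces to the GLOBAL class of ★ p851042∕p851143 by a parameter cut-off.

* §1 **`fderiv_slice_fst_apply_of_prod`** — `∂_v [q ↦ G(q, X)](q) = DG(q, X)·(v, 0)` for `G : Q × M → F` differentiable at `(q, X)` (the `M`-valued twin of ★ `fderiv_slice_fst_apply`).
* §2 **`exists_contDiff_tsupport_subset_eventually_eq_one`** — on a finite-dimensional `Q`, every neighbourhood `O` of `q₀` carries a `C^∞` compactly supported `χ` with `tsupport χ ⊆ O`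
  and `χ = 1` near `q₀` (Mathlib `ContDiffBump` on the Euclidean model, as in the ★ Hörmander engine).
* §3 **`exists_contDiff_uncurry_eventuallyEq_of_contDiffOn`** — LOCALISATION: `Θ` with `ContDiffOn ℝ ∞ (uncurry Θ) (O ×ˢ univ)`, `O` open, vanishing off `C` for parameters in `O`,
  and `q₀ ∈ O` ⇒ a family `Θ′` with `ContDiff ℝ ∞ (uncurry Θ′)`, vanishing off the SAME `C` for ALL parameters, and `Θ′ q = Θ q` for `q` near `q₀` (`Θ′ = (χ ∘ fst) • Θ`).
* §4 closure of the open-set class under `∂_v`: **`contDiffOn_uncurry_fderiv_apply_of_isOpen`** (`uncurry (∂_v Θ)` is `C^∞` on `O ×ˢ univ` — it is the directional derivative of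
  `uncurry Θ` along `(v, 0)` there, ★ `contDiffOn_dirDeriv`), **`fderiv_apply_eq_zero_of_forall_mem_isOpen`** (the support clause passes to `∂_v Θ` on `O`).
HONEST LABEL: generic calculus, count-neutral; HC_CM is proved only modulo the 7 printed citations (2 remaining: hLiu418 = `stmt-HodgeConjecture-24832`,
h413 = `stmt-HodgeConjecture-24833`) until rung 0 closes.

## References
* [HormanderALPDO1] L. Hörmander, *The Analysis of Linear Partial Differential Operators I*, 2nd ed. (1990), §1.4 Thm. 1.4.1 (cut-off functions), §1.1 Thm. 1.1.8.
-/

set_option autoImplicit false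

noncomputable section

open Set Filter Topology Function Metric
open scoped ContDiff

namespace Literature.Analysis.Calculus

/-! ## §1 The `Q × M` slice derivative -/

section Slice

variable {Q : Type*} [NormedAddCommGroup Q] [NormedSpace ℝ Q] {M : Type*} [NormedAddCommGroup M] [NormedSpace ℝ M]
  {F : Type*} [NormedAddCommGroup F] [NormedSpace ℝ F]

/-- **`∂_v [q ↦ G(q, X)](q) = DG(q, X)·(v, 0)`** for `G : Q × M → F` differentiable at `(q, X)` (chain rule along `q ↦ (q, X)`). [cite: HormanderALPDO1, §1.1 (1.1.3)] -/
theorem fderiv_slice_fst_apply_of_prod {G : Q × M → F} {x : Q × M} (hG : DifferentiableAt ℝ G x) (v : Q) :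
    fderiv ℝ (fun q : Q => G (q, x.2)) x.1 v = fderiv ℝ G x (v, (0 : M)) := by
  have hG' : HasFDerivAt G (fderiv ℝ G x) (x.1, x.2) := by rw [Prod.mk.eta]; exact hG.hasFDerivAt
  have h : HasFDerivAt (fun q : Q => G (q, x.2)) ((fderiv ℝ G x).comp (ContinuousLinearMap.inl ℝ Q M)) x.1 :=
    hG'.comp x.1 (hasFDerivAt_prodMk_left (𝕜 := ℝ) x.1 x.2)
  rw [h.fderiv, ContinuousLinearMap.comp_apply, ContinuousLinearMap.inl_apply]

end Slice

/-! ## §2 A smooth compactly supported cut-off equal to `1` near a point, inside a given neighbourhood (finite-dimensional parameter space) -/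

section Bump

variable {Q : Type*} [NormedAddCommGroup Q] [NormedSpace ℝ Q] [FiniteDimensional ℝ Q]

/-- **CUT-OFF INSIDE A NEIGHBOURHOOD**: for `O ∈ 𝓝 q₀` in a finite-dimensional real normed space there is `χ : Q → ℝ`, `C^∞` with compact support, `tsupport χ ⊆ O`, `χ = 1` near `q₀`
(Mathlib `ContDiffBump` on the Euclidean model `toEuclidean`). [cite: HormanderALPDO1, §1.4 Thm. 1.4.1] -/
theorem exists_contDiff_tsupport_subset_eventually_eq_one {O : Set Q} {q₀ : Q} (hO : O ∈ 𝓝 q₀) :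
    ∃ χ : Q → ℝ, ContDiff ℝ ∞ χ ∧ HasCompactSupport χ ∧ tsupport χ ⊆ O ∧ ∀ᶠ q in 𝓝 q₀, χ q = 1 := by
  set e : Q ≃L[ℝ] EuclideanSpace ℝ (Fin (Module.finrank ℝ Q)) := toEuclidean with he
  obtain ⟨ε, hε, hεO⟩ : ∃ ε > 0, Metric.closedBall (e q₀) ε ⊆ e.symm ⁻¹' O := by
    have hO' : e.symm ⁻¹' O ∈ 𝓝 (e q₀) := by
      refine e.symm.continuous.continuousAt.preimage_mem_nhds ?_
      rw [ContinuousLinearEquiv.symm_apply_apply]; exact hO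
    exact Metric.nhds_basis_closedBall.mem_iff.1 hO'
  let bump : ContDiffBump (e q₀) := ⟨ε / 2, ε, half_pos hε, half_lt_self hε⟩
  refine ⟨fun q => bump (e q), bump.contDiff.comp e.contDiff, bump.hasCompactSupport.comp_homeomorph e.toHomeomorph, ?_, ?_⟩
  · -- `tsupport (bump ∘ e) ⊆ e ⁻¹' closedBall (e q₀) ε ⊆ O`
    have hcl : IsClosed (e ⁻¹' Metric.closedBall (e q₀) ε) := Metric.isClosed_closedBall.preimage e.continuous
    refine (closure_minimal (fun q hq => ?_) hcl).trans fun q hq => ?_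
    · have hq' : bump (e q) ≠ 0 := hq
      exact bump.tsupport_eq ▸ subset_tsupport _ (Function.mem_support.2 hq')
    · have := hεO hq
      rwa [Set.mem_preimage, ContinuousLinearEquiv.symm_apply_apply] at this
  · have hev : ∀ᶠ q in 𝓝 q₀, e q ∈ Metric.closedBall (e q₀) (ε / 2) :=
      e.continuous.continuousAt.eventually_mem (Metric.closedBall_mem_nhds _ (half_pos hε))
    exact hev.mono fun q hq => bump.one_of_mem_closedBall hq

end Bump

/-! ## §3 Localisation: a family smooth on an open parameter set agrees near each parameter with a global family of the ★ class -/

section Localise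

variable {Q : Type*} [NormedAddCommGroup Q] [NormedSpace ℝ Q] [FiniteDimensional ℝ Q] {M : Type*} [NormedAddCommGroup M] [NormedSpace ℝ M]
  {F : Type*} [NormedAddCommGroup F] [NormedSpace ℝ F]

/-- **LOCALISATION OF AN OPEN-SET FAMILY.**  `O ⊆ Q` open (`Q` finite-dimensional), `Θ : Q → M → F` with `ContDiff ℝ ∞ (uncurry Θ)` ON `O ×ˢ univ` and `Θ q X = 0` for `q ∈ O`,
`X ∉ C`; then for every `q₀ ∈ O` there is `Θ′ : Q → M → F` with `ContDiff ℝ ∞ (uncurry Θ′)` (everywhere), `Θ′ q X = 0` for ALL `q` and `X ∉ C`, and `Θ′ q = Θ q` for all `q` near `q₀`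
— `Θ′ := (χ ∘ fst) • Θ` with §2's cut-off (`tsupport χ ⊆ O`, so outside `O` the product is locally `0`). [cite: HormanderALPDO1, §1.4 Thm. 1.4.1] -/
theorem exists_contDiff_uncurry_eventuallyEq_of_contDiffOn {O : Set Q} (hO : IsOpen O) {Θ : Q → M → F} (hΘ : ContDiffOn ℝ ∞ (Function.uncurry Θ) (O ×ˢ (univ : Set M)))
    {C : Set M} (h0 : ∀ q ∈ O, ∀ X : M, X ∉ C → Θ q X = 0) {q₀ : Q} (hq₀ : q₀ ∈ O) :
    ∃ Θ' : Q → M → F, ContDiff ℝ ∞ (Function.uncurry Θ') ∧ (∀ (q : Q) (X : M), X ∉ C → Θ' q X = 0) ∧ ∀ᶠ q in 𝓝 q₀, Θ' q = Θ q := by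
  obtain ⟨χ, hχ, -, hχO, hχ1⟩ := exists_contDiff_tsupport_subset_eventually_eq_one (hO.mem_nhds hq₀)
  refine ⟨fun q X => χ q • Θ q X, ?_, ?_, ?_⟩
  · refine contDiff_iff_contDiffAt.2 fun z => ?_
    by_cases hz : z.1 ∈ O
    · have hΘz : ContDiffAt ℝ ∞ (Function.uncurry Θ) z := hΘ.contDiffAt ((hO.prod isOpen_univ).mem_nhds (mk_mem_prod hz (mem_univ _)))
      exact ((hχ.comp contDiff_fst).contDiffAt (x := z)).smul hΘz
    · -- off `tsupport χ` the product vanishes identically near `z`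
      have hz' : z.1 ∉ tsupport χ := fun h => hz (hχO h)
      have hχ0 : χ =ᶠ[𝓝 z.1] 0 := notMem_tsupport_iff_eventuallyEq.1 hz'
      have hev : (Function.uncurry fun q X => χ q • Θ q X) =ᶠ[𝓝 z] fun _ => (0 : F) := by
        have h1 : ∀ᶠ y in 𝓝 z, χ y.1 = 0 := (continuous_fst.tendsto z).eventually hχ0
        exact h1.mono fun y hy => by rw [show Function.uncurry (fun q X => χ q • Θ q X) y = χ y.1 • Θ y.1 y.2 from rfl, hy, zero_smul]
      exact (contDiffAt_const (c := (0 : F))).congr_of_eventuallyEq hev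
  · intro q X hX
    by_cases hq : q ∈ O
    · simp only [h0 q hq X hX, smul_zero]
    · have hq' : q ∉ tsupport χ := fun h => hq (hχO h)
      simp only [image_eq_zero_of_notMem_tsupport hq', zero_smul]
  · exact hχ1.mono fun q hq => by funext X; simp only [hq, one_smul]

end Localise

/-! ## §4 The open-set class is closed under a parameter derivative -/

section OpenClass

variable {Q : Type*} [NormedAddCommGroup Q] [NormedSpace ℝ Q] {M : Type*} [NormedAddCommGroup M] [NormedSpace ℝ M]
  {F : Type*} [NormedAddCommGroup F] [NormedSpace ℝ F]

/-- **`uncurry (∂_v Θ)` is `C^∞` on `O ×ˢ univ` when `uncurry Θ` is** (`O` open): on that open set `∂_v Θ q X = D(uncurry Θ)(q, X)·(v, 0)` (§1), and directional derivatives of a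
function `C^∞` on an open set are `C^∞` there (★ `contDiffOn_dirDeriv`). [cite: HormanderALPDO1, §1.1 Thm. 1.1.8] -/
theorem contDiffOn_uncurry_fderiv_apply_of_isOpen {O : Set Q} (hO : IsOpen O) {Θ : Q → M → F}
    (hΘ : ContDiffOn ℝ ∞ (Function.uncurry Θ) (O ×ˢ (univ : Set M))) (v : Q) :
    ContDiffOn ℝ ∞ (Function.uncurry fun (q : Q) (X : M) => fderiv ℝ (fun q' : Q => Θ q' X) q v) (O ×ˢ (univ : Set M)) := by
  have hO' : IsOpen (O ×ˢ (univ : Set M)) := hO.prod isOpen_univ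
  refine (contDiffOn_dirDeriv hO' hΘ (v, (0 : M))).congr fun z hz => ?_
  have hd : DifferentiableAt ℝ (Function.uncurry Θ) z := (hΘ.contDiffAt (hO'.mem_nhds hz)).differentiableAt (by simp)
  show fderiv ℝ (fun q' : Q => Θ q' z.2) z.1 v = fderiv ℝ (Function.uncurry Θ) z (v, (0 : M))
  exact fderiv_slice_fst_apply_of_prod (G := Function.uncurry Θ) hd v

omit [NormedAddCommGroup M] [NormedSpace ℝ M] in
/-- **The support clause passes to `∂_v Θ` on an open parameter set**: if `Θ q X = 0` for all `q ∈ O` (`O` open) then `∂_v [q ↦ Θ q X](q) = 0` for all `q ∈ O`.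
[cite: HormanderALPDO1, §1.1 Thm. 1.1.8] -/
theorem fderiv_apply_eq_zero_of_forall_mem_isOpen {O : Set Q} (hO : IsOpen O) {Θ : Q → M → F} {X : M} (h0 : ∀ q ∈ O, Θ q X = 0) {q : Q} (hq : q ∈ O) (v : Q) :
    fderiv ℝ (fun q' : Q => Θ q' X) q v = 0 := by
  have hev : (fun q' : Q => Θ q' X) =ᶠ[𝓝 q] fun _ => (0 : F) := eventually_of_mem (hO.mem_nhds hq) fun q' hq' => h0 q' hq'
  rw [hev.fderiv_eq, fderiv_const_apply]
  rfl

omit [NormedAddCommGroup M] [NormedSpace ℝ M] in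
/-- The uniform-support clause of the open-set class passes to `∂_v Θ` (same compact `C`). [cite: HormanderALPDO1, §1.1 Thm. 1.1.8] -/
theorem forall_fderiv_apply_eq_zero_of_support_isOpen {O : Set Q} (hO : IsOpen O) {Θ : Q → M → F} {C : Set M}
    (h0 : ∀ q ∈ O, ∀ X : M, X ∉ C → Θ q X = 0) (v : Q) :
    ∀ q ∈ O, ∀ X : M, X ∉ C → fderiv ℝ (fun q' : Q => Θ q' X) q v = 0 :=
  fun _ hq X hX => fderiv_apply_eq_zero_of_forall_mem_isOpen hO (fun q' hq' => h0 q' hq' X hX) hq v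

end OpenClass

end Literature.Analysis.Calculus

end
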